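import Summits.AtomisticToContinuum.Crystallization.Theorems.OverbindingBudgetAffineBarlowSum

/-!
(SPLIT FOR THE 400-LINE CAP by the landing lane, hand-2 g29: this file = part A; part B = `…OverbindingBudgetAffineFarCoreCertificate` imports it; same namespace, all FQNs unchanged.)
# OverbindingBudget — the CERTIFICATE INTERFACE of the two CERT leaves Z2 `FarCoreExcess` and SB1 `ScaleBadCoreExcess`: scale elimination, the
# quadratic-model / non-far-ball / S-procedure soundness lemmas, and the assembly `FarCoreExcess ⟸ HcpEnergyUpper ∧ CoreFarShapeBound`
# (decomp-a2c lens-4, generation 64; critic row 1076 (2); memo `g64/memo/NODE-g64-CertificateInterface.md` §0–§5 has the numbers)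

Imports ONLY `…Theorems.OverbindingBudgetAffineBarlowSum` (the chart-sum majorant; transitively the Z2 vocabulary of `…FarSmoothSplit`); restates
nothing.  PROVED, 0 sorry:
* §1 SCALE ELIMINATION (Z2-E, SB1-E).  `invSix`, `invTwelve` (the `r⁻⁶`, `r⁻¹²` site series of a chart), `shapeSix`, `shapeTwelve` (the same at
  scale 1 — functions of the SHAPE `B†B` only); `inv_pow_barlowTriple_le` + `summable_invSix_chart` / `summable_invTwelve_chart` (both series are
  summable for a chart within `m ≤ 1/6` of an isometry, by the tree majorant `inv_norm_pow_six_le`); `refEnergy_eq_half` —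
  `refEnergy c = ½ (invTwelve c / 12 − invSix c / 6)`; `invSix_eq`, `invTwelve_eq` — `invSix c = a₀⁻⁶·shapeSix c`, `invTwelve c = a₀⁻¹²·shapeTwelve c`;
  ★ `le_refEnergy_of_sq_le` — `shapeSix² ≤ 24 Φ shapeTwelve ⇒ −Φ ≤ refEnergy c` (AM–GM in the scale: `a/24 − b/12 + b²/(24a) = (a−b)²/(24a)`; the
  scale is ELIMINATED, Z2 becomes a 5-dimensional SHAPE statement per registry window); ★ `scaleBad_target_of_quadratic` + `quad_nonneg_of_le` /
  `quad_nonneg_of_ge` + `inv_pow_six_ge_of_le` / `inv_pow_six_le_of_ge` — SB1's target `e + κ + q(1 + nn⁻¹²) ≤ refEnergy c` is a QUADRATIC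
  inequality `A x² − Bq x − C ≥ 0` in `x = a₀⁻⁶` whose coefficients are shape quantities; `Short`/`Long` put `x` on a monotone branch.
* §2 ZONE II (the excess shell) `annulus_lower` — from a quadratic model with cubic remainder, `f(E) ≥ e₀ − ‖g‖t + (λ/2)t² − c₃t³` (`t = ‖E‖`), and three
  scalar conditions, `f(E) ≥ e₀ − ‖g‖ r₀ + (1−η)(λ/2) r₀²` on the whole annulus `r₀ ≤ ‖E‖ ≤ r₁` (the kernel row (X2) checks the scalars in ℚ).
* §3 ZONE I (the non-far ball) `norm_sub_smul_le_of_near` / `not_farShape_of_near` — triangle inequalities: a shape within operator distance `r` of the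
  reference `X₀` whose two-shell defects `δ_v` satisfy `δ_v + 2 r ‖v‖ + θ′ r ≤ θ′` is NOT `θ′`-far (row (N)).
* §4 THE S-PROCEDURE (fallback row (SP)) `sProcedure_nonneg` — `q = τ g + σ b + Σ dᵢ ℓᵢ²` with `τ, σ, dᵢ ≥ 0` ⇒ `q ≥ 0` on `{g ≥ 0} ∩ {b ≥ 0}`.
* §5 ASSEMBLY.  `HcpEnergyUpper u` (Z2-U: `e⋆ ≤ u`, e.g. a truncated hcp lattice sum), `CoreFarShapeBound θ θ₀ Φ τ` (Z2-S: every admissible far chart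
  has `shapeSix² ≤ 24 Φ shapeTwelve`); ★ `farCoreExcess_of_shapeBound : HcpEnergyUpper u → CoreFarShapeBound θ θ₀ (−(u+κ+m)) τ → FarCoreExcess θ θ₀ κ`
  (`θ ≤ 1/18`, `m, τ > 0`); ★ `coreFarShapeBound_of_windows` — Z2-S from ANY window reduction supplying an UPPER bound for `shapeSix` and a LOWER bound
  for `shapeTwelve` (the monotonicity directions the registry-free far-layer bounds must respect) plus per-window certificates; record corollary
  `farCoreExcess_record_of_certificate` at `(1/25, 1/2000, 1/(2·10⁷))`, `m = 10⁻⁹`.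
* §6 ROW KERNELS over ℚ: `X2Row`/`x2Check`/★`x2Check_sound` (zone II: a passing row + the window's quadratic-model fact ⇒ the floor on the annulus) and
  `nCheck`/★`nCheck_sound` (zone I: a passing row + defect/norm enclosures ⇒ no far witness), each with a `decide`d demo row at the memo's hcp numbers.
NOT here (next generation, memo §2): the remaining ℚ row kernels `(X4) (SP) (BC) (SC)` with their `…_sound` lemmas, the
concrete window sums `T_s,w` (layer decomposition via `barlowPos`, coset max/min for `|k| > N`), and `PatternFar ⇒ FarShape` (pattern-map enumeration).
-/

namespace Summit.AtomisticToContinuum.Crystallization.Theorems.OverbindingBudgetAffineFarSmoothSplit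

open scoped BigOperators Classical
open Literature.MathematicalPhysics.StatisticalMechanics

local notation "E3" => EuclideanSpace ℝ (Fin 3)

/-! ## §1 Scale elimination -/

/-- The inverse-sixth-power site series `Σ_p (a₀‖B p‖)⁻⁶` of a chart (`p = 0` contributes `0⁻¹ = 0`). -/
noncomputable def invSix (c : Chart) : ℝ :=
  ∑' p : ↥(barlowStacking 1 (Real.sqrt (2 / 3)) c.s), (c.a₀ * ‖c.B (p : E3)‖)⁻¹ ^ 6

/-- The inverse-twelfth-power site series `Σ_p (a₀‖B p‖)⁻¹²` of a chart. -/
noncomputable def invTwelve (c : Chart) : ℝ :=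
  ∑' p : ↥(barlowStacking 1 (Real.sqrt (2 / 3)) c.s), (c.a₀ * ‖c.B (p : E3)‖)⁻¹ ^ 12

/-- The scale-free SHAPE sum `T₃ = Σ_p ‖B p‖⁻⁶` (depends on `B` only through `B†B`). -/
noncomputable def shapeSix (c : Chart) : ℝ :=
  ∑' p : ↥(barlowStacking 1 (Real.sqrt (2 / 3)) c.s), (‖c.B (p : E3)‖)⁻¹ ^ 6

/-- The scale-free SHAPE sum `T₆ = Σ_p ‖B p‖⁻¹²`. -/
noncomputable def shapeTwelve (c : Chart) : ℝ :=
  ∑' p : ↥(barlowStacking 1 (Real.sqrt (2 / 3)) c.s), (‖c.B (p : E3)‖)⁻¹ ^ 12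

/-- The separable `ℤ³` majorant `272³ (1+L²)⁻¹(1+i²)⁻¹(1+j²)⁻¹` is summable (from the tree's `summable_ljMajorant` at `a₀ = 1, m = 0`). [this file] -/
theorem summable_geomMajorant : Summable fun t : ℤ × ℤ × ℤ =>
    (272 : ℝ) ^ 3 * ((1 + (t.1 : ℝ) ^ 2)⁻¹ * ((1 + (t.2.1 : ℝ) ^ 2)⁻¹ * (1 + (t.2.2 : ℝ) ^ 2)⁻¹)) := by
  refine ((summable_ljMajorant 1 0).mul_left 4).congr fun t => ?_
  show 4 * ljMajorant 1 0 t = _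
  unfold ljMajorant
  norm_num
  ring

/-- **Pointwise domination of the inverse powers**: for a Hägg sequence `s`, `B` within `m ≤ 1/6` of a linear isometry and `a₀ > 0`,
`(a₀‖B p_t‖)⁻⁶ ≤ (a₀(1−m))⁻⁶ · maj(t)` and `(a₀‖B p_t‖)⁻¹² ≤ (a₀(1−m))⁻¹² · maj(t)`. [this file] -/
theorem inv_pow_barlowTriple_le {s : ℤ → ℤ} (hs : IsHaggSeq s) {B : E3 →ₗ[ℝ] E3} {m : ℝ} (hm : m ≤ 1 / 6)
    (hB : ∃ Q : E3 →ₗᵢ[ℝ] E3, ∀ v, ‖B v - Q v‖ ≤ m * ‖v‖) {a₀ : ℝ} (ha : 0 < a₀) (t : ℤ × ℤ × ℤ) :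
    (a₀ * ‖B (barlowTriple s t)‖)⁻¹ ^ 6 ≤ (a₀ * (1 - m))⁻¹ ^ 6 *
        ((272 : ℝ) ^ 3 * ((1 + (t.1 : ℝ) ^ 2)⁻¹ * ((1 + (t.2.1 : ℝ) ^ 2)⁻¹ * (1 + (t.2.2 : ℝ) ^ 2)⁻¹))) ∧
      (a₀ * ‖B (barlowTriple s t)‖)⁻¹ ^ 12 ≤ (a₀ * (1 - m))⁻¹ ^ 12 *
        ((272 : ℝ) ^ 3 * ((1 + (t.1 : ℝ) ^ 2)⁻¹ * ((1 + (t.2.1 : ℝ) ^ 2)⁻¹ * (1 + (t.2.2 : ℝ) ^ 2)⁻¹))) := by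
  obtain ⟨Q, hQ⟩ := hB
  obtain ⟨L, a, b⟩ := t
  have hc0 : 0 < a₀ * (1 - m) := by nlinarith
  simp only [barlowTriple]
  by_cases h0 : barlowPos 1 (Real.sqrt (2 / 3)) s L a b = 0
  · rw [h0, map_zero, norm_zero, mul_zero, inv_zero]
    norm_num
    constructor <;> positivity
  have hx1 : 1 ≤ ‖barlowPos 1 (Real.sqrt (2 / 3)) s L a b‖ :=
    one_le_norm_of_mem_barlowStacking hs (barlowPos_mem L a b) h0
  have hmaj := inv_norm_pow_six_le hs L a b h0
  obtain ⟨x, hx⟩ : ∃ x : ℝ, ‖barlowPos 1 (Real.sqrt (2 / 3)) s L a b‖ = x := ⟨_, rfl⟩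
  obtain ⟨P, hP⟩ : ∃ P : ℝ, (272 : ℝ) ^ 3 * ((1 + (L : ℝ) ^ 2)⁻¹ * ((1 + (a : ℝ) ^ 2)⁻¹ * (1 + (b : ℝ) ^ 2)⁻¹)) = P :=
    ⟨_, rfl⟩
  rw [hx] at hx1 hmaj
  rw [hP] at hmaj ⊢
  have hlow : (1 - m) * x ≤ ‖B (barlowPos 1 (Real.sqrt (2 / 3)) s L a b)‖ := by
    have h1 := norm_sub_norm_le (Q (barlowPos 1 (Real.sqrt (2 / 3)) s L a b))
      (Q (barlowPos 1 (Real.sqrt (2 / 3)) s L a b) - B (barlowPos 1 (Real.sqrt (2 / 3)) s L a b))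
    rw [sub_sub_cancel, Q.norm_map] at h1
    have h2 : ‖Q (barlowPos 1 (Real.sqrt (2 / 3)) s L a b) - B (barlowPos 1 (Real.sqrt (2 / 3)) s L a b)‖ ≤
        m * ‖barlowPos 1 (Real.sqrt (2 / 3)) s L a b‖ := by rw [norm_sub_rev]; exact hQ _
    rw [hx] at h1 h2
    linarith
  obtain ⟨ρ, hρ⟩ : ∃ ρ : ℝ, a₀ * ‖B (barlowPos 1 (Real.sqrt (2 / 3)) s L a b)‖ = ρ := ⟨_, rfl⟩
  rw [hρ]
  have hcx : 0 < a₀ * (1 - m) * x := mul_pos hc0 (by linarith)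
  have hρge : a₀ * (1 - m) * x ≤ ρ := by rw [← hρ]; nlinarith
  have hy : ρ⁻¹ ≤ (a₀ * (1 - m))⁻¹ * x⁻¹ := by rw [← mul_inv]; exact inv_anti₀ hcx hρge
  have hy0 : 0 ≤ ρ⁻¹ := by
    have : 0 < ρ := lt_of_lt_of_le hcx hρge
    positivity
  have hxi0 : 0 ≤ x⁻¹ := by
    have : 0 < x := by linarith
    positivity
  have hxi1 : x⁻¹ ≤ 1 := inv_le_one_of_one_le₀ hx1
  have hci0 : 0 ≤ (a₀ * (1 - m))⁻¹ := by positivity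
  have h6 : ρ⁻¹ ^ 6 ≤ (a₀ * (1 - m))⁻¹ ^ 6 * x⁻¹ ^ 6 := by
    rw [← mul_pow]; exact pow_le_pow_left₀ hy0 hy 6
  have h12 : ρ⁻¹ ^ 12 ≤ (a₀ * (1 - m))⁻¹ ^ 12 * x⁻¹ ^ 6 := by
    have h12' : ρ⁻¹ ^ 12 ≤ (a₀ * (1 - m))⁻¹ ^ 12 * x⁻¹ ^ 12 := by
      rw [← mul_pow]; exact pow_le_pow_left₀ hy0 hy 12
    have hx12 : x⁻¹ ^ 12 ≤ x⁻¹ ^ 6 := pow_le_pow_of_le_one hxi0 hxi1 (by norm_num)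
    exact h12'.trans (mul_le_mul_of_nonneg_left hx12 (by positivity))
  exact ⟨h6.trans (mul_le_mul_of_nonneg_left hmaj (by positivity)),
    h12.trans (mul_le_mul_of_nonneg_left hmaj (by positivity))⟩

/-- **The `r⁻⁶` site series of a chart is summable** (`m ≤ 1/6`-near an isometry, `a₀ > 0`). [this file] -/
theorem summable_invSix_chart {s : ℤ → ℤ} (hs : IsHaggSeq s) {B : E3 →ₗ[ℝ] E3} {m : ℝ} (hm : m ≤ 1 / 6)
    (hB : ∃ Q : E3 →ₗᵢ[ℝ] E3, ∀ v, ‖B v - Q v‖ ≤ m * ‖v‖) {a₀ : ℝ} (ha : 0 < a₀) :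
    Summable fun p : ↥(barlowStacking 1 (Real.sqrt (2 / 3)) s) => (a₀ * ‖B (p : E3)‖)⁻¹ ^ 6 := by
  rw [← (barlowEquiv s).summable_iff]
  refine Summable.of_norm_bounded (summable_geomMajorant.mul_left ((a₀ * (1 - m))⁻¹ ^ 6)) fun t => ?_
  rw [Function.comp_apply, barlowEquiv_apply, Real.norm_eq_abs, abs_of_nonneg (by positivity)]
  exact (inv_pow_barlowTriple_le hs hm hB ha t).1

/-- **The `r⁻¹²` site series of a chart is summable**. [this file] -/
theorem summable_invTwelve_chart {s : ℤ → ℤ} (hs : IsHaggSeq s) {B : E3 →ₗ[ℝ] E3} {m : ℝ} (hm : m ≤ 1 / 6)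
    (hB : ∃ Q : E3 →ₗᵢ[ℝ] E3, ∀ v, ‖B v - Q v‖ ≤ m * ‖v‖) {a₀ : ℝ} (ha : 0 < a₀) :
    Summable fun p : ↥(barlowStacking 1 (Real.sqrt (2 / 3)) s) => (a₀ * ‖B (p : E3)‖)⁻¹ ^ 12 := by
  rw [← (barlowEquiv s).summable_iff]
  refine Summable.of_norm_bounded (summable_geomMajorant.mul_left ((a₀ * (1 - m))⁻¹ ^ 12)) fun t => ?_
  rw [Function.comp_apply, barlowEquiv_apply, Real.norm_eq_abs, abs_of_nonneg (by positivity)]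
  exact (inv_pow_barlowTriple_le hs hm hB ha t).2

/-- **The three analytic facts an admissible chart supplies to the certificate** (`θ ≤ 1/18`, so `3θ ≤ 1/6`): both inverse-power series are summable and
`invTwelve c > 0` (the nearest-neighbour term is `nn⁻¹² > 0`). [this file] -/
theorem chart_series_facts {θ : ℝ} (hθ : θ ≤ 1 / 18) {c : Chart} (h : ChartAdmissible θ c) :
    (Summable fun p : ↥(barlowStacking 1 (Real.sqrt (2 / 3)) c.s) => (c.a₀ * ‖c.B (p : E3)‖)⁻¹ ^ 6) ∧
    (Summable fun p : ↥(barlowStacking 1 (Real.sqrt (2 / 3)) c.s) => (c.a₀ * ‖c.B (p : E3)‖)⁻¹ ^ 12) ∧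
    0 < invTwelve c := by
  obtain ⟨hs, ha, hnn, hB, -, ⟨p, hp, hp0, hnnp⟩, -⟩ := h
  have hm : 3 * θ ≤ 1 / 6 := by linarith
  have h6 := summable_invSix_chart hs hm hB ha
  have h12 := summable_invTwelve_chart hs hm hB ha
  refine ⟨h6, h12, ?_⟩
  unfold invTwelve
  refine h12.tsum_pos (fun q => by positivity) ⟨p, hp⟩ ?_
  have : 0 < c.a₀ * ‖c.B p‖ := by rw [← hnnp]; exact hnn
  positivity

/-- **The site energy splits**: `refEnergy c = ½ (invTwelve c / 12 − invSix c / 6)` once both series are summable. [this file] -/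
theorem refEnergy_eq_half (c : Chart)
    (h6 : Summable fun p : ↥(barlowStacking 1 (Real.sqrt (2 / 3)) c.s) => (c.a₀ * ‖c.B (p : E3)‖)⁻¹ ^ 6)
    (h12 : Summable fun p : ↥(barlowStacking 1 (Real.sqrt (2 / 3)) c.s) => (c.a₀ * ‖c.B (p : E3)‖)⁻¹ ^ 12) :
    refEnergy c = 1 / 2 * (invTwelve c / 12 - invSix c / 6) := by
  unfold refEnergy invSix invTwelve
  congr 1
  have hV : ∀ p : ↥(barlowStacking 1 (Real.sqrt (2 / 3)) c.s), lennardJones (c.a₀ * ‖c.B (p : E3)‖) =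
      1 / 12 * (c.a₀ * ‖c.B (p : E3)‖)⁻¹ ^ 12 - 1 / 6 * (c.a₀ * ‖c.B (p : E3)‖)⁻¹ ^ 6 := fun p => rfl
  rw [tsum_congr hV, (h12.mul_left (1 / 12)).tsum_sub (h6.mul_left (1 / 6)), tsum_mul_left, tsum_mul_left]
  ring

/-- `invSix c = a₀⁻⁶ · shapeSix c`. [this file] -/
theorem invSix_eq (c : Chart) : invSix c = (c.a₀⁻¹) ^ 6 * shapeSix c := by
  unfold invSix shapeSix
  rw [← tsum_mul_left]
  congr 1
  funext p
  rw [mul_inv, mul_pow]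

/-- `invTwelve c = a₀⁻¹² · shapeTwelve c`. [this file] -/
theorem invTwelve_eq (c : Chart) : invTwelve c = (c.a₀⁻¹) ^ 12 * shapeTwelve c := by
  unfold invTwelve shapeTwelve
  rw [← tsum_mul_left]
  congr 1
  funext p
  rw [mul_inv, mul_pow]

/-- **Scale elimination (Z2-E), series form**: if `invTwelve c > 0` and `invSix c ² ≤ 24 Φ · invTwelve c` then `−Φ ≤ refEnergy c`
(`½(a/12 − b/6) + Φ = ((a − b)² + (24Φa − b²))/(24a)`). [this file] -/
theorem le_refEnergy_of_inv_sq_le (c : Chart)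
    (h6 : Summable fun p : ↥(barlowStacking 1 (Real.sqrt (2 / 3)) c.s) => (c.a₀ * ‖c.B (p : E3)‖)⁻¹ ^ 6)
    (h12 : Summable fun p : ↥(barlowStacking 1 (Real.sqrt (2 / 3)) c.s) => (c.a₀ * ‖c.B (p : E3)‖)⁻¹ ^ 12)
    (hpos : 0 < invTwelve c) {Φ : ℝ} (h : invSix c ^ 2 ≤ 24 * Φ * invTwelve c) : -Φ ≤ refEnergy c := by
  rw [refEnergy_eq_half c h6 h12]
  obtain ⟨a, ha⟩ : ∃ a : ℝ, invTwelve c = a := ⟨_, rfl⟩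
  obtain ⟨b, hb⟩ : ∃ b : ℝ, invSix c = b := ⟨_, rfl⟩
  rw [ha, hb] at h ⊢
  rw [ha] at hpos
  have key : 1 / 2 * (a / 12 - b / 6) + Φ = ((a - b) ^ 2 + (24 * Φ * a - b ^ 2)) / (24 * a) := by
    field_simp
    ring
  have hnum : 0 ≤ ((a - b) ^ 2 + (24 * Φ * a - b ^ 2)) / (24 * a) :=
    div_nonneg (by nlinarith [sq_nonneg (a - b)]) (by positivity)
  linarith

/-- ★ **Scale elimination (Z2-E), shape form**: for a `θ`-admissible chart (`θ ≤ 1/18`), `shapeSix c ² ≤ 24 Φ · shapeTwelve c ⇒ −Φ ≤ refEnergy c`.  The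
hypothesis is SCALE-FREE (a statement about `B†B` on the 5-dimensional shape slice); the conclusion is the energy floor Z2 needs with
`Φ = −(u⁺ + κ + m)`. [this file] -/
theorem le_refEnergy_of_sq_le {θ : ℝ} (hθ : θ ≤ 1 / 18) {c : Chart} (hc : ChartAdmissible θ c) {Φ : ℝ}
    (h : shapeSix c ^ 2 ≤ 24 * Φ * shapeTwelve c) : -Φ ≤ refEnergy c := by
  obtain ⟨h6, h12, hpos⟩ := chart_series_facts hθ hc
  have ha : 0 < c.a₀ := hc.2.1
  refine le_refEnergy_of_inv_sq_le c h6 h12 hpos ?_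
  rw [invSix_eq, invTwelve_eq]
  have hx : 0 ≤ (c.a₀⁻¹) ^ 12 := by positivity
  calc ((c.a₀⁻¹) ^ 6 * shapeSix c) ^ 2 = (c.a₀⁻¹) ^ 12 * shapeSix c ^ 2 := by ring
    _ ≤ (c.a₀⁻¹) ^ 12 * (24 * Φ * shapeTwelve c) := mul_le_mul_of_nonneg_left h hx
    _ = 24 * Φ * ((c.a₀⁻¹) ^ 12 * shapeTwelve c) := by ring

/-- ★ **Scale elimination for the scale-BAD leaf (SB1-E)**: with `x := a₀⁻⁶` and `μ := nn/a₀` (the shape's nearest distance), SB1's target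
`e + κ + q(1 + nn⁻¹²) ≤ refEnergy c` IS the quadratic inequality `0 ≤ (shapeTwelve/24 − q μ⁻¹²) x² − (shapeSix/12) x − (e + κ + q)`. [this file] -/
theorem scaleBad_target_of_quadratic {θ : ℝ} (hθ : θ ≤ 1 / 18) {c : Chart} (hc : ChartAdmissible θ c) {e κ q : ℝ}
    (h : 0 ≤ (shapeTwelve c / 24 - q * ((c.nn / c.a₀)⁻¹) ^ 12) * ((c.a₀⁻¹) ^ 6) ^ 2 - shapeSix c / 12 * (c.a₀⁻¹) ^ 6 - (e + κ + q)) :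
    e + κ + q * (1 + (c.nn⁻¹) ^ 12) ≤ refEnergy c := by
  obtain ⟨h6, h12, -⟩ := chart_series_facts hθ hc
  have ha : 0 < c.a₀ := hc.2.1
  rw [refEnergy_eq_half c h6 h12, invSix_eq, invTwelve_eq]
  have hnn : (c.nn⁻¹) ^ 12 = ((c.a₀⁻¹) ^ 6) ^ 2 * ((c.nn / c.a₀)⁻¹) ^ 12 := by
    rw [← pow_mul, show (6 * 2 : ℕ) = 12 by norm_num, ← mul_pow, ← mul_inv, mul_div_cancel₀ _ ha.ne']
  rw [hnn]
  have hx12 : (c.a₀⁻¹) ^ 12 = ((c.a₀⁻¹) ^ 6) ^ 2 := by ring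
  rw [hx12]
  nlinarith [h]

/-- Monotone branch (increasing side): `A ≥ 0`, `B ≤ 2Ay`, `Ay² − By − C ≥ 0`, `y ≤ x` ⇒ `Ax² − Bx − C ≥ 0` — what a `Short` row uses
(`x = a₀⁻⁶ ≥ y = λ_S⁻⁶ ≥ x₊`). [this file] -/
theorem quad_nonneg_of_le {A B C y x : ℝ} (hA : 0 ≤ A) (hy : B ≤ 2 * A * y) (h0 : 0 ≤ A * y ^ 2 - B * y - C) (hx : y ≤ x) :
    0 ≤ A * x ^ 2 - B * x - C := by
  have h1 : 0 ≤ A * (x + y) - B := by nlinarith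
  nlinarith [mul_nonneg (sub_nonneg.2 hx) h1]

/-- Monotone branch (decreasing side): `A ≥ 0`, `2Ay ≤ B`, `Ay² − By − C ≥ 0`, `x ≤ y` ⇒ `Ax² − Bx − C ≥ 0` — what a `Long` row uses
(`x = a₀⁻⁶ ≤ y = λ_L⁻⁶ ≤ x₋`). [this file] -/
theorem quad_nonneg_of_ge {A B C y x : ℝ} (hA : 0 ≤ A) (hy : 2 * A * y ≤ B) (h0 : 0 ≤ A * y ^ 2 - B * y - C) (hx : x ≤ y) :
    0 ≤ A * x ^ 2 - B * x - C := by
  have h1 : A * (x + y) - B ≤ 0 := by nlinarith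
  nlinarith [mul_nonneg_of_nonpos_of_nonpos (sub_nonpos.2 hx) h1]

/-- `Short` puts `x = a₀⁻⁶` on the increasing branch: `0 < a₀`, `0 < μ`, `a₀ μ ≤ ℓ` ⇒ `(ℓ/μ)⁻⁶ ≤ a₀⁻⁶`. [this file] -/
theorem inv_pow_six_ge_of_le {a₀ μ ℓ : ℝ} (ha : 0 < a₀) (hμ : 0 < μ) (h : a₀ * μ ≤ ℓ) : ((ℓ / μ)⁻¹) ^ 6 ≤ (a₀⁻¹) ^ 6 := by
  have h1 : a₀ ≤ ℓ / μ := by rw [le_div_iff₀ hμ]; exact h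
  have h2 : 0 < ℓ / μ := lt_of_lt_of_le ha h1
  exact pow_le_pow_left₀ (inv_pos.2 h2).le (inv_anti₀ ha h1) 6

/-- `Long` puts `x = a₀⁻⁶` on the decreasing branch: `0 < ℓ`, `0 < ν`, `ℓ ≤ a₀ ν` ⇒ `a₀⁻⁶ ≤ (ℓ/ν)⁻⁶`. [this file] -/
theorem inv_pow_six_le_of_ge {a₀ ν ℓ : ℝ} (hℓ : 0 < ℓ) (hν : 0 < ν) (h : ℓ ≤ a₀ * ν) : (a₀⁻¹) ^ 6 ≤ ((ℓ / ν)⁻¹) ^ 6 := by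
  have h1 : ℓ / ν ≤ a₀ := by rw [div_le_iff₀ hν]; exact h
  have h2 : 0 < ℓ / ν := div_pos hℓ hν
  have ha : 0 < a₀ := lt_of_lt_of_le h2 h1
  exact pow_le_pow_left₀ (inv_pos.2 ha).le (inv_anti₀ h2 h1) 6

/-! ## §2 Zone II — the excess shell from a quadratic model with cubic remainder (row (X2)) -/

/-- **Annulus bound, scalar form**: if `e₀ − g t + (λ/2) t² − c₃ t³ ≤ φ` at some `t ∈ [r₀, r₁]` (`r₀ ≥ 0`), with `c₃ ≥ 0`, `c₃ r₁ ≤ η λ/2`, `η ≤ 1`,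
`0 ≤ λ` and `g ≤ (1−η) λ r₀` (`g ≥ 0` the gradient norm), then `e₀ − g r₀ + (1−η)(λ/2) r₀² ≤ φ`. [this file] -/
theorem annulus_lower_scalar {t r₀ r₁ e₀ g lam c₃ η φ : ℝ} (ht0 : r₀ ≤ t) (ht1 : t ≤ r₁) (hr₀ : 0 ≤ r₀)
    (hmodel : e₀ - g * t + lam / 2 * t ^ 2 - c₃ * t ^ 3 ≤ φ) (hc : 0 ≤ c₃) (hη : c₃ * r₁ ≤ η * (lam / 2)) (hη1 : η ≤ 1)
    (hlam : 0 ≤ lam) (hg : g ≤ (1 - η) * lam * r₀) :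
    e₀ - g * r₀ + (1 - η) * (lam / 2) * r₀ ^ 2 ≤ φ := by
  have ht : 0 ≤ t := le_trans hr₀ ht0
  have ht2 : 0 ≤ t ^ 2 := sq_nonneg t
  -- the cubic remainder eats at most `η λ/2` of the curvature on the ball
  have hcub : c₃ * t ^ 3 ≤ η * (lam / 2) * t ^ 2 := by
    have h1 : c₃ * t ≤ c₃ * r₁ := mul_le_mul_of_nonneg_left ht1 hc
    nlinarith
  -- the reduced quadratic `−g t + (1−η)(λ/2) t²` is increasing on `[r₀, ∞)`
  have hmono : -g * r₀ + (1 - η) * (lam / 2) * r₀ ^ 2 ≤ -g * t + (1 - η) * (lam / 2) * t ^ 2 := by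
    have hk : 0 ≤ (1 - η) * lam := mul_nonneg (by linarith) hlam
    have hk2 : 0 ≤ (1 - η) * lam * (t - r₀) := mul_nonneg hk (sub_nonneg.2 ht0)
    have h1 : 0 ≤ (1 - η) * (lam / 2) * (t + r₀) - g := by nlinarith
    nlinarith [mul_nonneg (sub_nonneg.2 ht0) h1]
  linarith

/-- **Annulus bound, vector form (zone II soundness)**: a function `f` on a real normed space dominating the quadratic model
`e₀ − g‖E‖ + (λ/2)‖E‖² − c₃‖E‖³` on the ball `‖E‖ ≤ r₁` is `≥ e₀ − g r₀ + (1−η)(λ/2) r₀²` on the annulus `r₀ ≤ ‖E‖ ≤ r₁`, under the three scalar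
conditions of `annulus_lower_scalar` (checked in ℚ by the row kernel; `λ` = a certified lower eigenvalue bound of the model Hessian). [this file] -/
theorem annulus_lower {V : Type*} [SeminormedAddCommGroup V] (f : V → ℝ) {r₀ r₁ e₀ g lam c₃ η : ℝ} (hr₀ : 0 ≤ r₀)
    (hmodel : ∀ E : V, ‖E‖ ≤ r₁ → e₀ - g * ‖E‖ + lam / 2 * ‖E‖ ^ 2 - c₃ * ‖E‖ ^ 3 ≤ f E)
    (hc : 0 ≤ c₃) (hη : c₃ * r₁ ≤ η * (lam / 2)) (hη1 : η ≤ 1) (hlam : 0 ≤ lam) (hg : g ≤ (1 - η) * lam * r₀) :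
    ∀ E : V, r₀ ≤ ‖E‖ → ‖E‖ ≤ r₁ → e₀ - g * r₀ + (1 - η) * (lam / 2) * r₀ ^ 2 ≤ f E :=
  fun E h0 h1 => annulus_lower_scalar h0 h1 hr₀ (hmodel E h1) hc hη hη1 hlam hg

/-! ## §3 Zone I — the non-far ball (row (N)) -/

/-- **One two-shell vector**: if `‖X − X₀‖ ≤ r` (operator norm), `|μ − 1| ≤ r`, `‖X₀ v − v‖ ≤ δ`, `0 ≤ θ′` and `δ + 2 r ‖v‖ + θ′ r ≤ θ′` then
`‖X v − μ • v‖ ≤ θ′ μ` (so `v` does not witness `θ′`-farness of `X` at nearest distance `μ`). [this file] -/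
theorem norm_sub_smul_le_of_near {v : E3} {X X₀ : E3 →L[ℝ] E3} {μ θ' r δ : ℝ} (hX : ‖X - X₀‖ ≤ r) (hμ : |μ - 1| ≤ r)
    (hδ : ‖X₀ v - v‖ ≤ δ) (hθ : 0 ≤ θ') (h : δ + 2 * r * ‖v‖ + θ' * r ≤ θ') : ‖X v - μ • v‖ ≤ θ' * μ := by
  have h1 : ‖(X - X₀) v‖ ≤ r * ‖v‖ := (ContinuousLinearMap.le_opNorm _ _).trans (mul_le_mul_of_nonneg_right hX (norm_nonneg _))
  have h2 : ‖v - μ • v‖ ≤ r * ‖v‖ := by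
    have : v - μ • v = (1 - μ) • v := by rw [sub_smul, one_smul]
    rw [this, norm_smul, Real.norm_eq_abs, abs_sub_comm]
    exact mul_le_mul_of_nonneg_right hμ (norm_nonneg _)
  have hsplit : X v - μ • v = (X - X₀) v + (X₀ v - v) + (v - μ • v) := by
    have e : (X - X₀) v = X v - X₀ v := by simp
    rw [e]; abel
  have h3 : ‖X v - μ • v‖ ≤ r * ‖v‖ + δ + r * ‖v‖ := by
    rw [hsplit]
    exact (norm_add₃_le).trans (by linarith)
  have hμ1 : 1 - r ≤ μ := by have := (abs_le.mp hμ).1; linarith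
  have h4 : θ' * (1 - r) ≤ θ' * μ := mul_le_mul_of_nonneg_left hμ1 hθ
  nlinarith

/-- **The nearest distance moves by at most `r`**: if `μ` is the minimum of `‖X p‖` and `1` the minimum of `‖X₀ p‖` over a family of UNIT vectors
(the first shell), and `‖X − X₀‖ ≤ r`, then `|μ − 1| ≤ r`. [this file] -/
theorem abs_nearest_sub_one_le {ι : Type*} {S : ι → E3} (hS : ∀ i, ‖S i‖ = 1) {X X₀ : E3 →L[ℝ] E3} {μ r : ℝ} (hX : ‖X - X₀‖ ≤ r)
    (hμle : ∀ i, μ ≤ ‖X (S i)‖) (hμeq : ∃ i, μ = ‖X (S i)‖) (h1le : ∀ i, 1 ≤ ‖X₀ (S i)‖) (h1eq : ∃ i, ‖X₀ (S i)‖ = 1) :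
    |μ - 1| ≤ r := by
  have hd : ∀ i, |‖X (S i)‖ - ‖X₀ (S i)‖| ≤ r := fun i => by
    have h2 := ContinuousLinearMap.le_opNorm (X - X₀) (S i)
    rw [hS i, mul_one] at h2
    have h3 : (X - X₀) (S i) = X (S i) - X₀ (S i) := by simp
    rw [h3] at h2
    exact ((abs_norm_sub_norm_le _ _).trans h2).trans hX
  rw [abs_le]
  constructor
  · obtain ⟨i, hi⟩ := hμeq
    have := (abs_le.mp (hd i)).1
    have := h1le i
    linarith
  · obtain ⟨i, hi⟩ := h1eq
    have := (abs_le.mp (hd i)).2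
    have := hμle i
    linarith

/-- **Row (N) soundness — the non-far ball**: with the first shell `S` (unit vectors) and the two-shell family `W`, a shape `X` within operator distance
`r` of the reference `X₀` (`min ‖X₀ S·‖ = 1`) whose reference defects satisfy `‖X₀ w − w‖ + 2 r ‖w‖ + θ′ r ≤ θ′` for every `w ∈ W` admits NO far
witness: `‖X w − μ • w‖ ≤ θ′ μ` for all `w`, `μ = min ‖X S·‖`. [this file] -/
theorem not_farShape_of_near {ι κ : Type*} {S : ι → E3} {W : κ → E3} (hS : ∀ i, ‖S i‖ = 1) {X X₀ : E3 →L[ℝ] E3} {μ θ' r : ℝ}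
    (hX : ‖X - X₀‖ ≤ r) (hμle : ∀ i, μ ≤ ‖X (S i)‖) (hμeq : ∃ i, μ = ‖X (S i)‖) (h1le : ∀ i, 1 ≤ ‖X₀ (S i)‖)
    (h1eq : ∃ i, ‖X₀ (S i)‖ = 1) (hθ : 0 ≤ θ') (hW : ∀ k, ‖X₀ (W k) - W k‖ + 2 * r * ‖W k‖ + θ' * r ≤ θ') :
    ∀ k, ‖X (W k) - μ • W k‖ ≤ θ' * μ :=
  fun k => norm_sub_smul_le_of_near hX (abs_nearest_sub_one_le hS hX hμle hμeq h1le h1eq) le_rfl hθ (hW k)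

/-! ## §4 The S-procedure (fallback row (SP)) -/

/-- **S-procedure soundness**: a pointwise identity `q = τ g + σ b + Σᵢ dᵢ ℓᵢ²` with `τ, σ, dᵢ ≥ 0` gives `q ≥ 0` wherever `g ≥ 0` and `b ≥ 0`
(the row kernel verifies the identity coefficientwise in ℚ for quadratic `q, g, b` and affine `ℓᵢ`, with the LDLᵀ data supplied by the table). [this file] -/
theorem sProcedure_nonneg {V : Type*} {n : ℕ} (q g b : V → ℝ) (ℓ : Fin n → V → ℝ) {τ σ : ℝ} {d : Fin n → ℝ} (hτ : 0 ≤ τ) (hσ : 0 ≤ σ)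
    (hd : ∀ i, 0 ≤ d i) (hid : ∀ E, q E = τ * g E + σ * b E + ∑ i, d i * ℓ i E ^ 2) :
    ∀ E, 0 ≤ g E → 0 ≤ b E → 0 ≤ q E := by
  intro E hg hb
  rw [hid E]
  have hs : 0 ≤ ∑ i, d i * ℓ i E ^ 2 := Finset.sum_nonneg fun i _ => mul_nonneg (hd i) (sq_nonneg _)
  positivity

end Summit.AtomisticToContinuum.Crystallization.Theorems.OverbindingBudgetAffineFarSmoothSplit
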